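import Summits.Ventures.QEC.Census.BB.BB756Rows
import Summits.Ventures.QEC.Census.BB.BB756RankWordsX
import Summits.Ventures.QEC.Census.RankRREF
import Literature.InformationTheory.QuantumCodes.CSSParameters
import HarnessLib

/-!
# `[[756,16,≤34]]`: `rank₂ H^X (BB.bb756) = 370` (kernel tier)

Kernel-checked rank of the `X`-check matrix of the bivariate-bicycle code `BB.bb756` = `QC(x³+y¹⁰+y¹⁷, y⁵+x³+x¹⁹)` on
`ℤ₂₁ × ℤ₁₈` (Bravyi–Cross–Gambetta–Maslov–Rall–Yoder, Nature 627 (2024), Extended Data Table 1 row `[[756,16,≤34]]`;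
`Literature/InformationTheory/QuantumCodes/BivariateBicycleCode756.lean`), by the MASKS-ONLY RREF certificate of
`Census/RankRREF.lean` (`rank_rowMatrix_of_derived`): the 370 reduced rows are DERIVED in the kernel as
`bb756maskX.map (xorMaskL H)` from the kernel-computed check rows `H = BBRows.rowsX la756 lb756` (`Census/BB/BB756Rows.lean`),
and ONE `decide +kernel` checks unit pivot columns (`pivotsOK`) and the re-assembly of every check row from its pivot bits
(`redSelL`); the identity `rowsX_bb756` transports the rank to the typed matrix `BB.bb756.HXFlat`. Measured: ≈ 120 s of
kernel time (the same certificate with 756-bit literal reduced rows: ≈ 580 s for `pivotsOK` alone). Tier KERNEL; no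
`native_decide`; axioms standard.


HONEST FRAMING: nothing here certifies the DISTANCE of `BB.bb756`; a rank only. The printed distance entry `≤ 34` is an
upper bound, not reproduced by the cell so far (qec-search-8 F-A0.1: explicit weight-40 logicals, `Census/BB/BB756Bound.lean`).
-/

namespace Summit.Ventures.QEC.Census.BB756

open Matrix Literature.InformationTheory.QuantumCodes BBRows

/-- The reduced rows of `H^X`, DERIVED in the kernel: XOR-combinations of the kernel-computed check rows selected by the
certificate's masks. (definition) -/
def redKX : List ℕ := bb756maskX.map (xorMaskL (rowsX la756 lb756))

set_option maxRecDepth 100000 in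
/-- The masks-only RREF certificate of `H^X` passes: unit pivot columns of the derived reduced rows AND re-assembly of all 378
check rows from their pivot bits (ONE `decide +kernel`, tier KERNEL, ≈ 120 s). -/
theorem coreX_ok : (pivotsOK 756 bb756pivX redKX &&
    ((rowsX la756 lb756).all fun h => redSelL bb756pivX redKX h == h)) = true := by
  decide +kernel

set_option maxHeartbeats 2000000 in -- large index types / literals met by the rewrite
set_option maxRecDepth 100000 in
/-- **`rank₂ H^X (BB.bb756) = 370`**: `rank_rowMatrix_of_derived` on the passing certificate, transported along `rowsX_bb756`
(CERTIFIED, kernel tier). -/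
theorem rank_bb756_HXFlat : BB.bb756.HXFlat.rank = 370 := by
  have h := coreX_ok
  rw [Bool.and_eq_true] at h
  rw [← rowsX_bb756]
  exact rank_rowMatrix_of_derived (by decide) h.1 h.2
end Summit.Ventures.QEC.Census.BB756
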